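import Mathlib
import HarnessLib
import Summits.FinalStateConjecture.Statement
import Literature.Geometry.Lorentzian.MinkowskiGlobalHyperbolicity

/-!
# Route PocketUniverses — `PocketsDefeatCharts` (item stmt-FinalStateConjecture-18856), closed

The support item of route `PocketUniverses` for the Final State Conjecture: a vacuum Cauchy
development `𝒟` carrying a POCKET STRUCTURE `(Q, 𝒯, T)` — an open `Q`, a hole tube `𝒯` and a
continuous function `T` monotone along the causal relation, with (a) a future-complete normalised
null ray from the data which is eventually in `Q ∖ closure 𝒯` with `T → ∞` along it, (b) every late
flat chart into `J⁺(Σ)` with `C²`-deviation `→ 0` has its slabs eventually disjoint from `J⁺(Q)`,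
(c) every late boosted-Kerr chart into `J⁺(Σ)` with honest growing radii and truncated
`C²`-deviation `→ 0` has its certified region inside `Q` eventually contained in `𝒯` and `T`
bounded on its converged truncated slabs `∩ J⁺(Q)` — admits no region `O` with a `C²` final-state
decomposition `d` such that `O = exteriorOf 𝒟 d.charted`, `RaysStayInClosure 𝒟 O` and
`HasExhaustiveCharts d`.

Proof (causal bookkeeping, as in the route text). `O ⊆ J⁺(Σ)`, so `d`'s own flat chart and hole
charts are late charts into `J⁺(Σ)`; (b) applied to the flat chart and (c) applied to each hole
chart with the exhaustive radii `Rᵢ` of `HasExhaustiveCharts d` give finitely many eventual times,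
beyond which we fix a chart time `τ₂ > τ₀`; `Θ` bounds `T` on the finitely many level-`τ₂` truncated
hole slabs `∩ J⁺(Q)`. Clause (a) yields a ray point `y ∈ Q ∖ closure 𝒯` with `T y > Θ`, and
`RaysStayInClosure` puts `y` in `closure O`, whence a point `x ∈ O ∩ Q ∖ closure 𝒯` with `T x > Θ`
(`Q`, `(closure 𝒯)ᶜ`, `{T > Θ}` are open). The point `x` is not certified-late at level `τ₂`: not in
a late flat slab (those are disjoint from `J⁺(Q) ⊇ Q`), not in a hole chart's certified region
(that part of `Q` lies in `𝒯`). By exhaustiveness `x ∈ J⁻(certified slab at τ₂)`, i.e. `x ≤ z`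
for a point `z` of that slab (time duality `LorentzianMetric.mem_causalPast_singleton_iff`), so
`T x ≤ T z`; `z` flat contradicts the disjointness again (`z ∈ J⁺(Q)`), `z` on a truncated hole slab
gives `T z ≤ Θ < T x`. Contradiction.

`pocketsDefeatCharts_proof` has exactly the type of the route decl
`Summit.FinalStateConjecture.FinalStateConjecture.Theses.PocketUniverses.PocketsDefeatCharts` (its
body verbatim); the route module is not imported, so that the gate-rendered route file can import
this module.
-/

set_option linter.dupNamespace false

noncomputable section

namespace Summit.FinalStateConjecture.FinalStateConjecture.Theorems

open scoped BigOperators Topology Manifold Classical MeasureTheory ProbabilityTheory Matrix InnerProductSpace ComplexConjugate ContinuousMap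
open Filter Set Function TopologicalSpace MeasureTheory

/-- **`PocketsDefeatCharts`** (item stmt-FinalStateConjecture-18856 of route `PocketUniverses`): a
vacuum Cauchy development carrying a pocket structure `(Q, 𝒯, T)` admits no region `O` with a `C²`
final-state decomposition `d`, `O = exteriorOf 𝒟 d.charted`, `RaysStayInClosure 𝒟 O` and
`HasExhaustiveCharts d`. The statement is VERBATIM the body of the route decl
`…Theses.PocketUniverses.PocketsDefeatCharts`. -/
theorem pocketsDefeatCharts_proof :
    ∀ (X : Type) [TopologicalSpace X] [ChartedSpace Literature.Geometry.Lorentzian.E3 X] [IsManifold (𝓡 3) ((⊤ : ℕ∞) : WithTop ℕ∞) X] [T2Space X] [SecondCountableTopology X] [ConnectedSpace X] (D : Literature.Geometry.Lorentzian.InitialDataSet (𝓡 3) X) (𝒟 : Literature.Geometry.Lorentzian.VacuumCauchyDevelopment D), (𝒟.metric.HasLeviCivita ∧ ∃ (Q 𝒯 : Set 𝒟.carrier) (T : 𝒟.carrier → ℝ), IsOpen Q ∧ Continuous T ∧ (∀ x z : 𝒟.carrier, z ∈ 𝒟.metric.causalFuture 𝒟.timeOrientation {x} → T x ≤ T z)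 ∧ (∀ [𝒟.metric.HasLeviCivita], ∃ V : Set X, IsOpen V ∧ V.Nonempty ∧ ∀ p ∈ V, ∃ (γ : ℝ → 𝒟.carrier) (dom : Set ℝ) (t₀ : ℝ), 𝒟.metric.IsNormalisedNullRayFrom 𝒟.timeOrientation 𝒟.embed 𝒟.normal p γ dom ∧ ¬ BddAbove dom ∧ 0 ≤ t₀ ∧ (∀ t ∈ dom, t₀ ≤ t → γ t ∈ Q ∧ γ t ∉ closure 𝒯) ∧ ∀ B : ℝ, ∃ t ∈ dom, t₀ ≤ t ∧ B < T (γ t)) ∧ (∀ (U₀ : TopologicalSpace.Opens Literature.Geometry.Lorentzian.E4) (Ψ₀ : U₀ → 𝒟.carrier) (s₁ : ℝ) (n : ℕ) (mo : Fin n → Literature.Geometry.Lorentzian.lorentzGroup × Literature.Geometry.Lorentzian.E4) (sp : Fin n → ℝ) (ρ : Fin n → ℝ → ℝ), (∀ i, Tendsto (fun t ↦ ρ i t / t) atTop (𝓝 0)) → {x : Literature.Geometry.Lorentzian.E4 | s₁ < x 0 ∧ ∀ i, ρ i (x 0) < Literature.Geometry.Lorentzian.Kerr.radius (sp i) (Literature.Geometry.Lorentzian.poincareInv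 (mo i).1 (mo i).2 x)} ⊆ (U₀ : Set Literature.Geometry.Lorentzian.E4) → 𝒟.toSpacetime.IsLateChart (Literature.Geometry.Lorentzian.Minkowski.backgroundOn U₀) (𝒟.metric.causalFuture 𝒟.timeOrientation (range 𝒟.embed)) s₁ Ψ₀ → Tendsto (fun s ↦ 𝒟.toSpacetime.deviationCk (Literature.Geometry.Lorentzian.Minkowski.backgroundOn U₀) Ψ₀ 2 s) atTop (𝓝 0) → ∃ s₀ : ℝ, ∀ s, s₀ ≤ s → Disjoint (Ψ₀ '' (Literature.Geometry.Lorentzian.Minkowski.backgroundOn U₀).timeSlab s) (𝒟.metric.causalFuture 𝒟.timeOrientation Q)) ∧ (∀ (Λ' : Literature.Geometry.Lorentzian.lorentzGroup) (c' : Literature.Geometry.Lorentzian.E4) (M' a' s₁ : ℝ) (Ψ : Literature.Geometry.Lorentzian.boostedKerrExterior Λ' c' M' a' → 𝒟.carrier) (R : ℝ → ℝ), 0 < M' → |a'| ≤ M' → 𝒟.toSpacetime.IsLateChart (Literature.Geometry.Lorentzian.boostedKerrBackground Λ' c' M' a') (𝒟.metric.causalFuture 𝒟.timeOrientation (range 𝒟.embed))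 s₁ Ψ → Tendsto R atTop atTop → (∀ s, max (Literature.Geometry.Lorentzian.Kerr.rPlus M' a') 0 + 1 ≤ R s) → Tendsto (fun s ↦ 𝒟.toSpacetime.truncDeviationCk (Literature.Geometry.Lorentzian.boostedKerrBackground Λ' c' M' a') Ψ 2 (R s) s) atTop (𝓝 0) → ∃ s₀ : ℝ, Ψ '' {x | s₀ < (Literature.Geometry.Lorentzian.boostedKerrBackground Λ' c' M' a').time x.1 ∧ (Literature.Geometry.Lorentzian.boostedKerrBackground Λ' c' M' a').radius x.1 ≤ R ((Literature.Geometry.Lorentzian.boostedKerrBackground Λ' c' M' a').time x.1)} ∩ Q ⊆ 𝒯 ∧ ∀ s, s₀ ≤ s → BddAbove (T '' (Ψ '' (Literature.Geometry.Lorentzian.boostedKerrBackground Λ' c' M' a').truncTimeSlab (R s) s ∩ 𝒟.metric.causalFuture 𝒟.timeOrientation Q)))) → ¬ ∃ (O : Set 𝒟.carrier) (d : Literature.Geometry.Lorentzian.FinalStateDecomposition 𝒟.toSpacetime O 2), O = Summit.FinalStateConjecture.exteriorOf 𝒟.toCauchyDevelopment d.charted ∧ Summit.FinalStateConjecture.RaysStayInClosure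 𝒟.toCauchyDevelopment O ∧ Summit.FinalStateConjecture.HasExhaustiveCharts d := by
  intro X _ _ _ _ _ _ D 𝒟 hpock
  rintro ⟨O, d, hO, hrays, hexh⟩
  obtain ⟨hLC, Q, 𝒯, T, hQ, hT, hmono, ha, hb, hc⟩ := hpock
  obtain ⟨R, hR, hdev, hcov⟩ := hexh
  -- `O = J⁺(Σ) ∩ I⁻(charted) ⊆ J⁺(Σ)`: the decomposition's charts are late charts into `J⁺(Σ)`
  have hOJ : O ⊆ 𝒟.metric.causalFuture 𝒟.timeOrientation (range 𝒟.embed) := by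
    intro w hw
    rw [hO] at hw
    exact hw.1
  -- (b) for the decomposition's own flat chart
  obtain ⟨s₀, hs₀⟩ := hb d.flatDomain d.flatChart d.τ₀ d.N d.motion d.spin d.excision
    d.tendsto_excision_div d.setOf_lt_excision_subset_flatDomain
    ⟨d.isLateChart_flat.contMDiff, d.isLateChart_flat.isOpenEmbedding,
      d.isLateChart_flat.image_subset.trans hOJ⟩
    d.tendsto_deviationCk_flat
  -- (c) for each of the decomposition's own hole charts, with the exhaustive radii `R i`
  choose s₁ hs₁T hs₁B using fun i : Fin d.N ↦
    hc (d.motion i).1 (d.motion i).2 (d.mass i) (d.spin i) d.τ₀ (d.chart i) (R i) (d.mass_pos i)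
      (d.abs_spin_le_mass i)
      ⟨(d.isLateChart i).contMDiff, (d.isLateChart i).isOpenEmbedding,
        (d.isLateChart i).image_subset.trans hOJ⟩
      (hR i).1 (hR i).2 (hdev i)
  -- a chart time `τ₂ > τ₀` beyond the finitely many eventualities
  obtain ⟨σ, hσ⟩ := Finite.exists_le s₁
  obtain ⟨τ₂, hτ₂₀, hτ₂s₀, hτ₂σ⟩ : ∃ τ₂ : ℝ, d.τ₀ < τ₂ ∧ s₀ ≤ τ₂ ∧ ∀ i, s₁ i ≤ τ₂ := by
    refine ⟨max (max (d.τ₀ + 1) s₀) σ, ?_, (le_max_right _ _).trans (le_max_left _ _),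
      fun i ↦ (hσ i).trans (le_max_right _ _)⟩
    have h1 : d.τ₀ + 1 ≤ max (max (d.τ₀ + 1) s₀) σ := (le_max_left _ _).trans (le_max_left _ _)
    linarith
  -- `Θ` bounds `T` on the level-`τ₂` truncated hole slabs `∩ J⁺(Q)`
  choose θ hθ using fun i : Fin d.N ↦ hs₁B i τ₂ (hτ₂σ i)
  obtain ⟨Θ, hΘ⟩ := Finite.exists_le θ
  -- a late pocket-ray point `γ t ∈ Q ∖ closure 𝒯` with `T (γ t) > Θ`, in `closure O`
  obtain ⟨V, -, ⟨p, hp⟩, hV⟩ := @ha hLC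
  obtain ⟨γ, dom, t₀, hγ, hdom, ht₀, hin, hbig⟩ := hV p hp
  obtain ⟨t, ht, ht₀t, hΘt⟩ := hbig Θ
  obtain ⟨hyQ, hy𝒯⟩ := hin t ht ht₀t
  have hycl : γ t ∈ closure O := @hrays hLC p γ dom hγ hdom t ht (ht₀.trans ht₀t)
  -- hence a point `x ∈ O ∩ Q ∖ closure 𝒯` with `T x > Θ`
  have hW : IsOpen (Q ∩ (closure 𝒯)ᶜ ∩ T ⁻¹' Ioi Θ) :=
    (hQ.inter isClosed_closure.isOpen_compl).inter (isOpen_Ioi.preimage hT)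
  obtain ⟨x, ⟨⟨hxQ, hx𝒯⟩, hxΘ⟩, hxO⟩ := _root_.mem_closure_iff.1 hycl _ hW ⟨⟨hyQ, hy𝒯⟩, hΘt⟩
  have hxΘ' : Θ < T x := hxΘ
  -- `x` is not certified-late at level `τ₂`
  have hxlate : x ∉ certifiedLate d R τ₂ := by
    rintro (⟨u, hu, rfl⟩ | hx)
    · have hu' : τ₂ < (Literature.Geometry.Lorentzian.Minkowski.backgroundOn d.flatDomain).time u.1 :=
        hu
      exact Set.disjoint_left.1 (hs₀ _ (hτ₂s₀.trans hu'.le)) ⟨u, rfl, rfl⟩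
        (Literature.Geometry.Lorentzian.LorentzianMetric.subset_causalFuture _ _ _ hxQ)
    · obtain ⟨i, u, hu, rfl⟩ := mem_iUnion.1 hx
      have hu₁ : τ₂ < (d.background i).time u.1 := hu.1
      have hu₂ : (d.background i).radius u.1 ≤ R i ((d.background i).time u.1) := hu.2
      exact hx𝒯 (subset_closure (hs₁T i ⟨⟨u, ⟨(hτ₂σ i).trans_lt hu₁, hu₂⟩, rfl⟩, hxQ⟩))
  -- so `x` lies in the causal past of the certified slab at level `τ₂`: `x ≤ z`
  have hxpast := hcov τ₂ hτ₂₀ ⟨hxO, hxlate⟩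
  obtain ⟨z, hz, hxz⟩ : ∃ z ∈ certifiedSlab d R τ₂,
      z ∈ 𝒟.metric.causalFuture 𝒟.timeOrientation {x} := by
    unfold Literature.Geometry.Lorentzian.LorentzianMetric.causalPast at hxpast
    rw [Literature.Geometry.Lorentzian.LorentzianMetric.causalFuture_eq_biUnion, mem_iUnion₂]
      at hxpast
    obtain ⟨z, hz, hxz⟩ := hxpast
    exact ⟨z, hz,
      Literature.Geometry.Lorentzian.LorentzianMetric.mem_causalPast_singleton_iff.1 hxz⟩
  have hTxz : T x ≤ T z := hmono x z hxz
  have hzQ : z ∈ 𝒟.metric.causalFuture 𝒟.timeOrientation Q :=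
    Literature.Geometry.Lorentzian.LorentzianMetric.causalFuture_mono
      (singleton_subset_iff.2 hxQ) hxz
  rcases hz with ⟨v, hv, rfl⟩ | hz
  · -- `z` on the flat slab at `τ₂`: contradicts (b), as `z ∈ J⁺(Q)`
    exact Set.disjoint_left.1 (hs₀ τ₂ hτ₂s₀) ⟨v, hv, rfl⟩ hzQ
  · -- `z` on a truncated hole slab at `τ₂`: `T z ≤ Θ < T x ≤ T z`
    obtain ⟨i, v, hv, rfl⟩ := mem_iUnion.1 hz
    have h1 : T (d.chart i v) ≤ θ i := hθ i ⟨d.chart i v, ⟨⟨v, hv, rfl⟩, hzQ⟩, rfl⟩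
    linarith [hΘ i]

end Summit.FinalStateConjecture.FinalStateConjecture.Theorems

end
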